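import Mathlib
import Literature.Combinatorics.Optimization.ApproximateConicalJuntas
import Literature.Computability.Complexity.LindseyLemma
import HarnessLib

/-!
# Kothari–Meka–Raghavendra 2017, §5 (Lemmas 5.1 and 5.3): the inner-product gadget applied to
# (conjunctive) blockwise-dense sources gives an `ε`-decaying density, resp. a conjunction times `(1 + h)`
# (with the Chor–Goldreich bound from Lindsey's lemma) — PROVED

Source: P. K. Kothari, R. Meka, P. Raghavendra, *Approximating rectangles by juntas and weakly-exponential
lower bounds for LP relaxations of CSPs*, STOC 2017 / SIAM J. Comput. (doi:10.1137/17M1152966) =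
arXiv:1610.02704 [KothariMekaRaghavendra2017]; held text `paper:arxiv-1610.02704` (arXiv source, read
first-hand 2026-08-28): Def. 2.6/3.2 (min-entropy), Def. 2.8/2.9 (blockwise-dense, conjunctive blockwise-dense,
aligned), §5 Lemma 5.1, Fact 5.2, eq. (5.1), Lemma 5.3. The extractor bound is proved from Lindsey's lemma in the weighted form of the tree
(`Literature.Computability.Complexity.lindsey_sq`, after S. Jukna, *Boolean Function Complexity*, 2012,
Appendix A [Jukna2012]); the paper attributes it to B. Chor, O. Goldreich (1988).

CONTEXT. These are steps B1 and B2 of the costed map of `KothariMekaRaghavendra2017_thm110` (KMR Thm 1.10 =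
Lemma 2.3 + Lemma 2.4; Lemma 2.4 is PROVED in `ApproximateConicalJuntas.lean`; Lemma 2.3 = §4.1 + §5 + §6):
the "extractor-like property of the slightly modified inner-product function" used in §5, and its
refinement for aligned conjunctive-blockwise-dense sources. What then remains of §5 is Theorem 5.5 (= Thm
2.7), which is Lemma 5.3 pushed through the rectangular decomposition Theorem 6.4 of §6 (not here).

THE PRINTED STATEMENTS (arXiv source).
* Def. 2.8: "A distribution `X` on `[q]ⁿ` is blockwise-dense if for every `I ⊆ [n]`,
  `H_∞(X_I) ≥ 0.8 · log q · |I|`", `q = 2^b`, `H_∞(u) = min_x log(1/Pr[X = x])` (Def. 2.6). Exponentiated: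
  `Pr[X_I = ξ] ≤ (q^{−0.8})^{|I|}` for every `I` and `ξ`. Typed with a general per-block parameter `θ`
  in place of `q^{−0.8}`: `IsBlockwiseDense θ P` ⇔ `Pr_P[X_I = ξ] ≤ θ^{|I|}` for all `I, ξ`
  (the printed notion is `θ = 2^{−0.8 b}`; nothing below depends on the value `0.8`).
* Fact 5.2 (Chor–Goldreich, as quoted): "Suppose `X, Y` are independent random variables over `{−1,1}^ℓ`
  for `ℓ > 7` with min-entropy `H_∞(X), H_∞(Y) ≥ 0.8ℓ`. Let `h(X,Y) = (−1)^{⊕_i X_i Y_i}`. Then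
  `|E[h(X,Y)]| ≤ 2^{−0.6ℓ+1}`."
* **Lemma 5.1.** "Fix `q = 2^b` for `b > 50` and identify `[q]` with `{−1,1}^b`. Let `IP` be the Boolean
  inner product function [the gadget `IP(x,y) = (−1)^{x_1 ⊕ y_1} (−1)^{⊕_i x_i y_i}` of Def. 1.7]. Suppose
  `X` and `Y` are independent, blockwise-dense random variables on `[q]ⁿ`. Let `ν` be the density of the
  random variable `IP^{⊗n}(X,Y)` on `{−1,1}ⁿ`. Then, `ν = 1 + h` for an `ε`-decaying function `h` where
  `ε = 2^{−0.5b}`."  Printed proof: `ν̂(S) = E[IP^{⊗|S|}(X_S, Y_S)]`, bounded blockwise by Fact 5.2.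
* Def. 2.9: "`X` on `[q]ⁿ` is a `d`-CBD (conjunctive blockwise-dense) distribution if for some `I ⊆ [n]`,
  `|I| ≤ d`, `H_∞(X_I) = 0` and for every `J ⊆ [n] ∖ I`, `H_∞(X_J) ≥ 0.8 · log q · |J|` … two `d`-CBD
  distributions `X, Y` are aligned if the fixed blocks `I` are the same in both." Typed by its data: the
  fixed blocks `I`, the fixed values (`P` supported on `{x_I = α_I}`, `Q` on `{y_I = β_I}`), and the
  max-probability bounds `θ^{|S|}` for the `S`-block marginals, `S ∩ I = ∅`.
* **Lemma 5.3.** "Let `X, Y` be aligned `d`-CBD random variables over `({0,1}^b)ⁿ` for `b > 7` with the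
  aligned blocks `I ⊆ [n]` and `X_I = α`, `Y_I = β`. Let `ν` be the density of `z = IP^{⊗n}(X,Y)`. Then, for
  `ε = 2^{−0.5b}`, there exists an `ε`-decaying function `h` such that `ν = 𝟙[z_I = IP^{⊗|I|}(α,β)]·(1+h)`
  [`𝟙` = the mean-one indicator, i.e. the conjunction `C_{I,·}`]. In particular, if `u, v` are aligned
  `d`-CBD densities over `({−1,1}^b)ⁿ`, then `Acc_{u,v}` is a `(2^{−.5b}, 0)`-approximate conical
  `d`-junta."

WHAT IS PROVED HERE, AND A REPAIR OF THE PRINTED CONSTANT. For probability vectors `P, Q` on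
`({0,1}^b)ⁿ` (the row/column index type `Fin n → Fin b → Bool` of the tree's `ipPatternMatrix`) that are
blockwise-dense with parameters `θ₁, θ₂`, and the gadget map `G(x,y)_i = ipGadget b (x i) (y i)` (the
tree's `ipGadget`, `true ↔ −1`):
* `sq_sum_mul_ipSign_le` — the Chor–Goldreich bound in the form Lindsey's lemma gives, for arbitrary
  bounded sign weights: `(Σ_{x,y} P(x) Q(y) s(x) t(y) (−1)^{⟨x,y⟩})² ≤ θ₁ θ₂ 2^ℓ` whenever `P ≤ θ₁`,
  `Q ≤ θ₂` pointwise (i.e. `H_∞ ≥ log(1/θ)`), `|s|, |t| ≤ 1`. At `θ₁ = θ₂ = 2^{−0.8ℓ}` this is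
  `|E h| ≤ 2^{−0.3ℓ}` — NOT the quoted `2^{−0.6ℓ+1}`: the printed Fact 5.2 doubles the exponent
  (Chor–Goldreich's bound is `2^{(ℓ − H_∞(X) − H_∞(Y))/2}`). Recorded, not silently changed: the
  statements below carry the honest rate.
* `abs_sum_walsh_ipMap_le` — **Lemma 5.1's Fourier estimate**: for every `S ⊆ [n]`,
  `|E_{P⊗Q}[χ_S(G(X,Y))]| ≤ ε^{|S|}` as soon as `θ₁ θ₂ 2^b ≤ ε²` (so `ε = 2^{−0.3b}` for the printed
  `θ = 2^{−0.8b}`, for EVERY `b ≥ 1`; the printed `2^{−0.5b}`, `b > 50` rests on the misquoted constant).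
  Proof as printed — `χ_S(G(x,y)) = (Π_{i∈S} (−1)^{x_{i1}})(Π_{i∈S} (−1)^{y_{i1}}) · (−1)^{⟨x_S, y_S⟩}` and
  the `S`-block marginals have max-probability `≤ θ^{|S|}` — except that the sign factors are absorbed into
  the weights of the (weighted) Lindsey lemma instead of being removed by conditioning on the first bits.
* `isDecaying_ipOutputDensity_sub_one` — **Lemma 5.1 as printed, with the honest `ε`**: the density
  `ν(z) = 2ⁿ · Pr[G(X,Y) = z]` of the gadget's output satisfies `ν = 1 + h` with `h` `ε`-decaying
  (`IsDecaying`, Def. 2.1, file `ApproximateConicalJuntas.lean`).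
* `exists_isDecaying_ipOutputDensity_eq_conjunction_mul` — **Lemma 5.3** (honest `ε`): for aligned
  conjunctive-blockwise-dense sources, `ν = C_{I,G(α,β)} · (1 + h)` with `h` `ε`-decaying; proof as printed
  (`Z_I` is fixed on the support; `h(z) = 2^{−|I|} ν(z|_{I←G(α,β)}) − 1` reads only `z_{Ī}` and has
  `ĥ(T) = ν̂(T) − [T = ∅]` for `T ∩ I = ∅`, bounded by the one-level form
  `abs_sum_walsh_ipMap_le_of_blockMass_le` of Lemma 5.1), and its "in particular":
  `isApproxConicalJunta_ipOutputDensity` — `ν` is an `(ε,0)`-approximate conical `d`-junta (`|I| ≤ d`).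
Everything is proved; no named facts. Downstream (Lemma 2.3 / Thm 1.10) only `ε = 2^{−Ω(b)}` is used, so
the repaired rate changes nothing but the unprinted constants `c, C` of Theorem 1.10.

What this is NOT: not Theorem 5.5 / 2.7 (which needs the §6 decomposition), not the decomposition Theorem 6.4,
not Lemma 2.3 / Theorem 1.10; no P-vs-NP content. Consumer: cell pnp-psdrank,
row (5) of the literature-typing layer. No instances, no notation, standard axioms.
-/

noncomputable section

open Finset
open Literature.Probability.RandomGraphs.LowDegree (walsh sgn walsh_empty sgn_true sgn_false)
open Literature.Computability.Complexity.LowDegree (cubeFourierCoeff sum_cubeFourierCoeff_mul_walsh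
  cubeFourierCoeff_empty sum_walsh_mul_walsh_index cubeFourierCoeff_piecewise_eq_zero)
open Literature.Computability.Complexity (ipSign lindsey_sq ipSign_eq_pow abs_ipSign)

namespace Literature.Combinatorics.Optimization

variable {n b : ℕ}

/-! ### Block strings, block marginals, blockwise density (Def. 2.8 in exponentiated form) -/

/-- The restriction of a block string `x ∈ ({0,1}^b)ⁿ` to the blocks in `S`, as one bit string indexed by
`S × [b]` (the printed `X_S`). [cite: KothariMekaRaghavendra2017, §5 (proof of Lemma 5.1: "X_S = Π_{i∈S} X_{{i}}")] -/
def blockRestrict (S : Finset (Fin n)) (x : Fin n → Fin b → Bool) : (↥S × Fin b) → Bool :=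
  fun p => x p.1.1 p.2

/-- The marginal mass `Pr_P[X_S = ξ]` of the blocks in `S`. [cite: KothariMekaRaghavendra2017, Def. 2.6/2.8 (min-entropy of X_I)] -/
def blockMass (P : (Fin n → Fin b → Bool) → ℝ) (S : Finset (Fin n)) (ξ : (↥S × Fin b) → Bool) : ℝ :=
  ∑ x ∈ univ.filter (fun x : Fin n → Fin b → Bool => blockRestrict S x = ξ), P x

/-- **Blockwise-dense with parameter `θ`** (KMR Def. 2.8 exponentiated, `θ = q^{−0.8} = 2^{−0.8b}` in
print): every `S`-block marginal has max-probability `≤ θ^{|S|}`, i.e. `H_∞(X_S) ≥ |S|·log(1/θ)` for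
every `S ⊆ [n]`. [cite: KothariMekaRaghavendra2017, Def. 2.8 (§2.3)] -/
def IsBlockwiseDense (θ : ℝ) (P : (Fin n → Fin b → Bool) → ℝ) : Prop :=
  ∀ (S : Finset (Fin n)) (ξ : (↥S × Fin b) → Bool), blockMass P S ξ ≤ θ ^ S.card

/-- The gadget map `G = IP^{⊗n} : ({0,1}^b)ⁿ × ({0,1}^b)ⁿ → {0,1}ⁿ`, `G(x,y)_i = IP(x_i, y_i)` with the
tree's `ipGadget` (`true ↔ −1`). [cite: KothariMekaRaghavendra2017, Def. 1.7 and §4 ("G := g^{⊗n}")] -/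
def ipMap (b : ℕ) (x y : Fin n → Fin b → Bool) : Fin n → Bool := fun i => ipGadget b (x i) (y i)

/-- The density `ν(z) = 2ⁿ · Pr_{X∼P, Y∼Q}[G(X,Y) = z]` of the gadget's output (KMR: "the density of the
random variable `IP^{⊗n}(X,Y)` on `{−1,1}ⁿ`"; densities are normalised to `E ν = 1`, Def. 2.5/3.1).
[cite: KothariMekaRaghavendra2017, Lemma 5.1 (§5) and Def. 2.5] -/
def ipOutputDensity (P Q : (Fin n → Fin b → Bool) → ℝ) : (Fin n → Bool) → ℝ :=
  fun z => (2 : ℝ) ^ n * ∑ x, ∑ y, if ipMap b x y = z then P x * Q y else 0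

/-- Block masses of a non-negative vector are non-negative. [cite: KothariMekaRaghavendra2017, Def. 2.6] -/
theorem blockMass_nonneg {P : (Fin n → Fin b → Bool) → ℝ} (hP0 : ∀ x, 0 ≤ P x) (S : Finset (Fin n))
    (ξ : (↥S × Fin b) → Bool) : 0 ≤ blockMass P S ξ :=
  sum_nonneg fun x _ => hP0 x

/-- **Marginalisation**: `Σ_x P(x) F(x_S) = Σ_ξ Pr_P[X_S = ξ] F(ξ)`. [cite: KothariMekaRaghavendra2017, §5 (proof of Lemma 5.1)] -/
theorem sum_mul_comp_blockRestrict (P : (Fin n → Fin b → Bool) → ℝ) (S : Finset (Fin n))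
    (F : ((↥S × Fin b) → Bool) → ℝ) :
    ∑ x, P x * F (blockRestrict S x) = ∑ ξ, blockMass P S ξ * F ξ := by
  classical
  rw [← Finset.sum_fiberwise univ (blockRestrict S) (fun x => P x * F (blockRestrict S x))]
  refine sum_congr rfl fun ξ _ => ?_
  unfold blockMass
  rw [Finset.sum_mul]
  refine sum_congr rfl fun x hx => ?_
  rw [(mem_filter.1 hx).2]

/-- The block masses sum to the total mass. [cite: KothariMekaRaghavendra2017, Def. 2.6] -/
theorem sum_blockMass (P : (Fin n → Fin b → Bool) → ℝ) (S : Finset (Fin n)) :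
    ∑ ξ, blockMass P S ξ = ∑ x, P x := by
  have h := sum_mul_comp_blockRestrict P S (fun _ => 1)
  simp only [mul_one] at h
  exact h.symm

/-! ### The Chor–Goldreich bound from Lindsey's lemma (Fact 5.2, with the honest exponent) -/

/-- **Fact 5.2 (Chor–Goldreich) in the form Lindsey's lemma gives, weighted by bounded signs.** For
probability vectors `P ≤ θ₁`, `Q ≤ θ₂` on `{0,1}^ℓ` (min-entropies `≥ log 1/θ₁`, `≥ log 1/θ₂`) and weights
`|s|, |t| ≤ 1`: `(Σ_{x,y} P(x)Q(y) s(x)t(y) (−1)^{⟨x,y⟩})² ≤ θ₁ θ₂ 2^ℓ`, i.e.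
`|E[s(X)t(Y)(−1)^{⟨X,Y⟩}]| ≤ 2^{(ℓ − H_∞(X) − H_∞(Y))/2}`. (Lindsey: `(Σ a_x b_y H_{xy})² ≤ ‖a‖²2^ℓ‖b‖²`,
and `‖P s‖² ≤ Σ P² ≤ θ₁ Σ P = θ₁`.) At `θᵢ = 2^{−0.8ℓ}` this is `2^{−0.3ℓ}`; the printed quotation
`2^{−0.6ℓ+1}` doubles the exponent (see the module docstring). [cite: KothariMekaRaghavendra2017, Fact 5.2 (§5)] [cite: Jukna2012, Appendix A (Lindsey's Lemma)] -/
theorem sq_sum_mul_ipSign_le {m : Type*} [Fintype m] [DecidableEq m] {P Q : (m → Bool) → ℝ}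
    {θ₁ θ₂ : ℝ} (hP0 : ∀ x, 0 ≤ P x) (hP1 : ∑ x, P x = 1) (hPθ : ∀ x, P x ≤ θ₁)
    (hQ0 : ∀ y, 0 ≤ Q y) (hQ1 : ∑ y, Q y = 1) (hQθ : ∀ y, Q y ≤ θ₂)
    (s t : (m → Bool) → ℝ) (hs : ∀ x, |s x| ≤ 1) (ht : ∀ y, |t y| ≤ 1) :
    (∑ x, ∑ y, P x * Q y * (s x * t y * ipSign x y)) ^ 2 ≤ θ₁ * θ₂ * 2 ^ Fintype.card m := by
  have h := lindsey_sq (fun x => P x * s x) (fun y => Q y * t y)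
  have hre : ∑ x, ∑ y, P x * Q y * (s x * t y * ipSign x y) =
      ∑ x, ∑ y, (P x * s x) * (Q y * t y) * ipSign x y :=
    sum_congr rfl fun x _ => sum_congr rfl fun y _ => by ring
  have ha : ∑ x, (P x * s x) ^ 2 ≤ θ₁ := by
    calc ∑ x, (P x * s x) ^ 2 ≤ ∑ x, θ₁ * P x := by
          refine sum_le_sum fun x _ => ?_
          have hs2 : s x ^ 2 ≤ 1 := (sq_le_one_iff_abs_le_one (s x)).2 (hs x)
          have hP2 : P x * P x ≤ θ₁ * P x := mul_le_mul_of_nonneg_right (hPθ x) (hP0 x)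
          have hPx2 : 0 ≤ P x ^ 2 := sq_nonneg _
          nlinarith
      _ = θ₁ := by rw [← Finset.mul_sum, hP1, mul_one]
  have hb : ∑ y, (Q y * t y) ^ 2 ≤ θ₂ := by
    calc ∑ y, (Q y * t y) ^ 2 ≤ ∑ y, θ₂ * Q y := by
          refine sum_le_sum fun y _ => ?_
          have ht2 : t y ^ 2 ≤ 1 := (sq_le_one_iff_abs_le_one (t y)).2 (ht y)
          have hQ2 : Q y * Q y ≤ θ₂ * Q y := mul_le_mul_of_nonneg_right (hQθ y) (hQ0 y)
          have hQy2 : 0 ≤ Q y ^ 2 := sq_nonneg _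
          nlinarith
      _ = θ₂ := by rw [← Finset.mul_sum, hQ1, mul_one]
  have ha0 : 0 ≤ ∑ x, (P x * s x) ^ 2 := sum_nonneg fun x _ => sq_nonneg _
  have hb0 : 0 ≤ ∑ y, (Q y * t y) ^ 2 := sum_nonneg fun y _ => sq_nonneg _
  rw [hre]
  calc (∑ x, ∑ y, (P x * s x) * (Q y * t y) * ipSign x y) ^ 2
      ≤ (∑ x, (P x * s x) ^ 2) * ((2 : ℝ) ^ Fintype.card m * ∑ y, (Q y * t y) ^ 2) := h
    _ ≤ θ₁ * ((2 : ℝ) ^ Fintype.card m * θ₂) :=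
        mul_le_mul ha (mul_le_mul_of_nonneg_left hb (by positivity)) (by positivity) (ha0.trans ha)
    _ = θ₁ * θ₂ * 2 ^ Fintype.card m := by ring

/-! ### The gadget's sign: `(−1)^{IP(u,v)} = (−1)^{u₁} (−1)^{v₁} (−1)^{⟨u,v⟩}` -/

/-- **The sign of the gadget**: for `b ≥ 1`,
`(−1)^{IP(u,v)} = (−1)^{u_1} · (−1)^{v_1} · (−1)^{#{j : u_j ∧ v_j}}` (the tree's `ipSign`).
[cite: KothariMekaRaghavendra2017, Def. 1.7 ("IP(x,y) = (−1)^{x_1⊕y_1}·(−1)^{⊕_i x_i y_i}")] -/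
theorem sgn_ipGadget (hb : 0 < b) (u v : Fin b → Bool) :
    sgn (ipGadget b u v) = sgn (u ⟨0, hb⟩) * sgn (v ⟨0, hb⟩) * ipSign u v := by
  -- `(−1)^{p ⊕ q} = (−1)^p (−1)^q` and `(−1)^{k mod 2} = (−1)^k` (in the tree as `ShrinkageParity.sgn_xor`,
  -- `LDC.sgn_bodd` in far-away modules; re-derived inline to keep the imports of this file light)
  have hxor : ∀ p q : Bool, sgn (xor p q) = sgn p * sgn q := by
    intro p q
    cases p <;> cases q <;> simp [sgn]
  have hbodd : ∀ k : ℕ, sgn k.bodd = (-1 : ℝ) ^ k := by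
    intro k
    induction k with
    | zero => simp [sgn]
    | succ k ih =>
      rw [Nat.bodd_succ, pow_succ, ← ih]
      cases k.bodd <;> simp [sgn]
  unfold ipGadget
  rw [dif_pos hb, hxor, hxor, hbodd, ipSign_eq_pow]

/-- The product of the gadget signs over the blocks in `S` equals the inner-product sign of the
concatenated `S`-blocks: `Π_{i∈S} (−1)^{⟨x_i,y_i⟩} = (−1)^{⟨x_S, y_S⟩}`.
[cite: KothariMekaRaghavendra2017, §5 (proof of Lemma 5.1: "E[Π_{i∈S} IP(X_{{i}},Y_{{i}})] = E[IP(X_S,Y_S)]")] -/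
theorem prod_ipSign_eq_ipSign_blockRestrict (S : Finset (Fin n)) (x y : Fin n → Fin b → Bool) :
    ∏ i ∈ S, ipSign (x i) (y i) = ipSign (blockRestrict S x) (blockRestrict S y) := by
  unfold Literature.Computability.Complexity.ipSign
  rw [Fintype.prod_prod_type, ← Finset.prod_coe_sort S]
  rfl

/-- **`χ_S(G(x,y))` factorises** as `(Π_{i∈S} (−1)^{x_{i1}}) (Π_{i∈S} (−1)^{y_{i1}}) (−1)^{⟨x_S,y_S⟩}`
(for `b ≥ 1`). [cite: KothariMekaRaghavendra2017, §5 (proof of Lemma 5.1)] -/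
theorem walsh_ipMap (hb : 0 < b) (S : Finset (Fin n)) (x y : Fin n → Fin b → Bool) :
    walsh S (ipMap b x y) =
      (∏ i ∈ S, sgn (x i ⟨0, hb⟩)) * (∏ i ∈ S, sgn (y i ⟨0, hb⟩)) *
        ipSign (blockRestrict S x) (blockRestrict S y) := by
  unfold Literature.Probability.RandomGraphs.LowDegree.walsh ipMap
  simp_rw [sgn_ipGadget hb]
  rw [Finset.prod_mul_distrib, Finset.prod_mul_distrib, prod_ipSign_eq_ipSign_blockRestrict]

/-! ### Lemma 5.1: the Fourier coefficients of the output density -/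

/-- **KMR Lemma 5.1, the Fourier estimate at one level set `S` (PROVED, honest rate).** Let `P, Q` be
probability vectors on `({0,1}^b)ⁿ` (`b ≥ 1`) whose `S`-block marginals have max-probability `≤ θ₁^{|S|}`,
`≤ θ₂^{|S|}` (`θᵢ ≥ 0`), and `ε ≥ 0` with `θ₁ θ₂ 2^b ≤ ε²`. Then `|E_{X∼P,Y∼Q}[χ_S(G(X,Y))]| ≤ ε^{|S|}`.
(Only the `S`-marginals enter — this is what Lemma 5.3 uses off the fixed blocks.)
(Printed: `ν̂(S) = E[IP^{⊗|S|}(X_S,Y_S)]`, then Fact 5.2 on the `b|S|` bits of the `S`-blocks; here the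
`S`-blocks are marginalised (`sum_mul_comp_blockRestrict`), their masses are `≤ θ^{|S|}`, and
`sq_sum_mul_ipSign_le` is applied on `{0,1}^{S×[b]}` with the first-bit signs as weights. With the printed
`θ = 2^{−0.8b}` one may take `ε = 2^{−0.3b}`.) [cite: KothariMekaRaghavendra2017, Lemma 5.1 (§5)] -/
theorem abs_sum_walsh_ipMap_le_of_blockMass_le (hb : 0 < b) {θ₁ θ₂ ε : ℝ} (hθ₁ : 0 ≤ θ₁)
    (hθ₂ : 0 ≤ θ₂) (hε0 : 0 ≤ ε) (hε : θ₁ * θ₂ * 2 ^ b ≤ ε ^ 2) {P Q : (Fin n → Fin b → Bool) → ℝ}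
    (hP0 : ∀ x, 0 ≤ P x) (hP1 : ∑ x, P x = 1) (hQ0 : ∀ y, 0 ≤ Q y) (hQ1 : ∑ y, Q y = 1)
    (S : Finset (Fin n)) (hPS : ∀ ξ, blockMass P S ξ ≤ θ₁ ^ S.card)
    (hQS : ∀ ζ, blockMass Q S ζ ≤ θ₂ ^ S.card) :
    |∑ x, ∑ y, P x * Q y * walsh S (ipMap b x y)| ≤ ε ^ S.card := by
  classical
  -- the first-bit sign of the `S`-blocks, read off the restriction
  set sg : ((↥S × Fin b) → Bool) → ℝ := fun ξ => ∏ i : ↥S, sgn (ξ (i, ⟨0, hb⟩)) with hsg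
  have hsg_eq : ∀ x : Fin n → Fin b → Bool, ∏ i ∈ S, sgn (x i ⟨0, hb⟩) = sg (blockRestrict S x) := by
    intro x
    rw [hsg]
    simp only [blockRestrict]
    rw [← Finset.prod_coe_sort S]
  have hsg_abs : ∀ ξ, |sg ξ| ≤ 1 := by
    intro ξ
    rw [hsg]
    simp only
    rw [Finset.abs_prod]
    refine le_of_eq (Finset.prod_eq_one fun i _ => ?_)
    cases ξ (i, ⟨0, hb⟩) <;> simp [sgn]
  -- rewrite the expectation as a double sum over the `S`-block marginals
  have hstep : ∑ x, ∑ y, P x * Q y * walsh S (ipMap b x y) =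
      ∑ ξ, ∑ ζ, blockMass P S ξ * blockMass Q S ζ * (sg ξ * sg ζ * ipSign ξ ζ) := by
    -- inner sum over `y`
    have hy : ∀ x : Fin n → Fin b → Bool, ∑ y, P x * Q y * walsh S (ipMap b x y) =
        P x * sg (blockRestrict S x) *
          ∑ ζ, blockMass Q S ζ * (sg ζ * ipSign (blockRestrict S x) ζ) := by
      intro x
      rw [← sum_mul_comp_blockRestrict Q S (fun ζ => sg ζ * ipSign (blockRestrict S x) ζ),
        Finset.mul_sum]
      refine sum_congr rfl fun y _ => ?_
      rw [walsh_ipMap hb, hsg_eq x, hsg_eq y]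
      ring
    simp_rw [hy]
    -- outer sum over `x`
    have hx := sum_mul_comp_blockRestrict P S
      (fun ξ => sg ξ * ∑ ζ, blockMass Q S ζ * (sg ζ * ipSign ξ ζ))
    have hx' : ∑ x, P x * sg (blockRestrict S x) *
        ∑ ζ, blockMass Q S ζ * (sg ζ * ipSign (blockRestrict S x) ζ) =
        ∑ x, P x * (fun ξ => sg ξ * ∑ ζ, blockMass Q S ζ * (sg ζ * ipSign ξ ζ)) (blockRestrict S x) :=
      sum_congr rfl fun x _ => by simp only; ring
    rw [hx', hx]
    refine sum_congr rfl fun ξ _ => ?_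
    show blockMass P S ξ * (sg ξ * ∑ ζ, blockMass Q S ζ * (sg ζ * ipSign ξ ζ)) = _
    rw [Finset.mul_sum, Finset.mul_sum]
    refine sum_congr rfl fun ζ _ => ?_
    ring
  rw [hstep]
  -- Chor–Goldreich on `{0,1}^{S × [b]}`
  have hmassP1 : ∑ ξ, blockMass P S ξ = 1 := by rw [sum_blockMass, hP1]
  have hmassQ1 : ∑ ζ, blockMass Q S ζ = 1 := by rw [sum_blockMass, hQ1]
  have hsq := sq_sum_mul_ipSign_le (blockMass_nonneg hP0 S) hmassP1 hPS
    (blockMass_nonneg hQ0 S) hmassQ1 hQS sg sg hsg_abs hsg_abs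
  have hcard : Fintype.card (↥S × Fin b) = S.card * b := by
    rw [Fintype.card_prod, Fintype.card_coe, Fintype.card_fin]
  rw [hcard] at hsq
  -- `θ₁^k θ₂^k 2^{kb} = (θ₁ θ₂ 2^b)^k ≤ (ε²)^k = (ε^k)²`
  have hpow : θ₁ ^ S.card * θ₂ ^ S.card * (2 : ℝ) ^ (S.card * b) ≤ (ε ^ S.card) ^ 2 := by
    calc θ₁ ^ S.card * θ₂ ^ S.card * (2 : ℝ) ^ (S.card * b)
        = (θ₁ * θ₂ * 2 ^ b) ^ S.card := by
          rw [mul_pow, mul_pow, ← pow_mul, mul_comm b]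
      _ ≤ (ε ^ 2) ^ S.card := pow_le_pow_left₀ (by positivity) hε _
      _ = (ε ^ S.card) ^ 2 := by rw [← pow_mul, ← pow_mul, mul_comm]
  exact abs_le_of_sq_le_sq (hsq.trans hpow) (pow_nonneg hε0 _)

/-- **KMR Lemma 5.1, the Fourier estimate for blockwise-dense sources**: for `P, Q` blockwise-dense with
parameters `θ₁, θ₂` and `θ₁ θ₂ 2^b ≤ ε²`, `|E[χ_S(G(X,Y))]| ≤ ε^{|S|}` for EVERY `S`. With the printed
`θ = 2^{−0.8b}`: `ε = 2^{−0.3b}`. [cite: KothariMekaRaghavendra2017, Lemma 5.1 (§5)] -/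
theorem abs_sum_walsh_ipMap_le (hb : 0 < b) {θ₁ θ₂ ε : ℝ} (hθ₁ : 0 ≤ θ₁) (hθ₂ : 0 ≤ θ₂) (hε0 : 0 ≤ ε)
    (hε : θ₁ * θ₂ * 2 ^ b ≤ ε ^ 2) {P Q : (Fin n → Fin b → Bool) → ℝ}
    (hP0 : ∀ x, 0 ≤ P x) (hP1 : ∑ x, P x = 1) (hPd : IsBlockwiseDense θ₁ P)
    (hQ0 : ∀ y, 0 ≤ Q y) (hQ1 : ∑ y, Q y = 1) (hQd : IsBlockwiseDense θ₂ Q) (S : Finset (Fin n)) :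
    |∑ x, ∑ y, P x * Q y * walsh S (ipMap b x y)| ≤ ε ^ S.card :=
  abs_sum_walsh_ipMap_le_of_blockMass_le hb hθ₁ hθ₂ hε0 hε hP0 hP1 hQ0 hQ1 S (hPd S) (hQd S)

/-! ### Lemma 5.1: the output density is `1 + h` with `h` decaying -/

/-- The Fourier–Walsh coefficients of the output density are the expectations of the characters of the
output: `ν̂(S) = E[χ_S(G(X,Y))]`. [cite: KothariMekaRaghavendra2017, §5 (proof of Lemma 5.1: "ν̂(S) = E[ν(z)χ_S(z)] = E_{z∼ν}[χ_S(z)]")] -/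
theorem cubeFourierCoeff_ipOutputDensity (P Q : (Fin n → Fin b → Bool) → ℝ) (S : Finset (Fin n)) :
    cubeFourierCoeff (ipOutputDensity P Q) S = ∑ x, ∑ y, P x * Q y * walsh S (ipMap b x y) := by
  classical
  unfold Literature.Computability.Complexity.LowDegree.cubeFourierCoeff ipOutputDensity
  have h2 : (2 : ℝ) ^ n ≠ 0 := pow_ne_zero _ two_ne_zero
  -- pull out `2ⁿ` and exchange the sums
  have hz : ∀ z : Fin n → Bool,
      (2 : ℝ) ^ n * (∑ x, ∑ y, if ipMap b x y = z then P x * Q y else 0) * walsh S z =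
        (2 : ℝ) ^ n * ∑ x, ∑ y, (if ipMap b x y = z then P x * Q y * walsh S z else 0) := by
    intro z
    rw [mul_assoc, Finset.sum_mul]
    congr 1
    refine sum_congr rfl fun x _ => ?_
    rw [Finset.sum_mul]
    refine sum_congr rfl fun y _ => ?_
    split_ifs <;> simp
  simp_rw [hz]
  rw [← Finset.mul_sum, mul_div_cancel_left₀ _ h2]
  rw [Finset.sum_comm]
  refine sum_congr rfl fun x _ => ?_
  rw [Finset.sum_comm]
  refine sum_congr rfl fun y _ => ?_
  rw [Finset.sum_ite_eq]
  simp

/-- `ν̂(∅) = E ν = 1`: the output density is a density. [cite: KothariMekaRaghavendra2017, Def. 2.5 and §2.2 ("Acc is a density")] -/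
theorem cubeFourierCoeff_ipOutputDensity_empty {P Q : (Fin n → Fin b → Bool) → ℝ}
    (hP1 : ∑ x, P x = 1) (hQ1 : ∑ y, Q y = 1) :
    cubeFourierCoeff (ipOutputDensity P Q) ∅ = 1 := by
  rw [cubeFourierCoeff_ipOutputDensity]
  simp only [walsh_empty, mul_one]
  have : ∀ x : Fin n → Fin b → Bool, ∑ y, P x * Q y = P x := fun x => by
    rw [← Finset.mul_sum, hQ1, mul_one]
  simp_rw [this]
  exact hP1

/-- **KMR Lemma 5.1 — PROVED** (with the honest rate; see the module docstring). Let `P, Q` be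
probability vectors on `({0,1}^b)ⁿ`, `b ≥ 1`, blockwise-dense with parameters `θ₁, θ₂ ≥ 0`, and let
`ε ≥ 0` satisfy `θ₁ θ₂ 2^b ≤ ε²`. Then the density `ν` of `G(X,Y) = IP^{⊗n}(X,Y)` (`X ∼ P`, `Y ∼ Q`
independent) is `ν = 1 + h` with `h = ν − 1` `ε`-decaying: `E h = 0` and `|ĥ(S)| ≤ ε^{|S|}` for all `S`.
"Suppose `X` and `Y` are independent, blockwise-dense random variables on `[q]ⁿ`. Let `ν` be the density of
the random variable `IP^{⊗n}(X,Y)` on `{−1,1}ⁿ`. Then, `ν = 1 + h` for an `ε`-decaying function `h`"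
(printed with `ε = 2^{−0.5b}`, `b > 50`; with the printed `θ = 2^{−0.8b}` the proved rate is `ε = 2^{−0.3b}`
for every `b ≥ 1`). [cite: KothariMekaRaghavendra2017, Lemma 5.1 (§5)] -/
theorem isDecaying_ipOutputDensity_sub_one (hb : 0 < b) {θ₁ θ₂ ε : ℝ} (hθ₁ : 0 ≤ θ₁) (hθ₂ : 0 ≤ θ₂)
    (hε0 : 0 ≤ ε) (hε : θ₁ * θ₂ * 2 ^ b ≤ ε ^ 2) {P Q : (Fin n → Fin b → Bool) → ℝ}
    (hP0 : ∀ x, 0 ≤ P x) (hP1 : ∑ x, P x = 1) (hPd : IsBlockwiseDense θ₁ P)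
    (hQ0 : ∀ y, 0 ≤ Q y) (hQ1 : ∑ y, Q y = 1) (hQd : IsBlockwiseDense θ₂ Q) :
    IsDecaying ε (fun z => ipOutputDensity P Q z - 1) := by
  classical
  -- coefficients of `ν − 1`
  have hcoef : ∀ S : Finset (Fin n), cubeFourierCoeff (fun z => ipOutputDensity P Q z - 1) S =
      cubeFourierCoeff (ipOutputDensity P Q) S - (if S = ∅ then 1 else 0) := by
    intro S
    unfold Literature.Computability.Complexity.LowDegree.cubeFourierCoeff
    have h1 : ∑ z : Fin n → Bool, (1 : ℝ) * walsh S z = if S = ∅ then (2 : ℝ) ^ n else 0 := by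
      have := sum_walsh_mul_walsh_index (∅ : Finset (Fin n)) S
      simp only [walsh_empty] at this
      rw [this]
      by_cases hS : S = ∅
      · rw [if_pos hS, if_pos hS.symm]
      · rw [if_neg hS, if_neg (Ne.symm hS)]
    have hsplit : ∑ z : Fin n → Bool, (ipOutputDensity P Q z - 1) * walsh S z =
        ∑ z, ipOutputDensity P Q z * walsh S z - ∑ z, (1 : ℝ) * walsh S z := by
      rw [← Finset.sum_sub_distrib]
      exact sum_congr rfl fun z _ => by ring
    rw [hsplit, h1, sub_div]
    congr 1
    split_ifs
    · exact div_self (pow_ne_zero _ two_ne_zero)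
    · simp
  refine ⟨?_, fun S => ?_⟩
  · -- `E h = ĥ(∅) = ν̂(∅) − 1 = 0`
    have h0 : cubeExpect (fun z => ipOutputDensity P Q z - 1) =
        cubeFourierCoeff (fun z => ipOutputDensity P Q z - 1) ∅ := by
      rw [cubeFourierCoeff_empty]; rfl
    rw [h0, hcoef, if_pos rfl, cubeFourierCoeff_ipOutputDensity_empty hP1 hQ1, sub_self]
  · rw [hcoef]
    by_cases hS : S = ∅
    · subst hS
      rw [if_pos rfl, cubeFourierCoeff_ipOutputDensity_empty hP1 hQ1, sub_self, abs_zero]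
      positivity
    · rw [if_neg hS, sub_zero, cubeFourierCoeff_ipOutputDensity]
      exact abs_sum_walsh_ipMap_le hb hθ₁ hθ₂ hε0 hε hP0 hP1 hPd hQ0 hQ1 hQd S

/-- Lemma 5.1 in the "`ν = 1 + h`" phrasing: there is an `ε`-decaying `h` with `ν = 1 + h` pointwise.
[cite: KothariMekaRaghavendra2017, Lemma 5.1 (§5)] -/
theorem exists_isDecaying_ipOutputDensity_eq (hb : 0 < b) {θ₁ θ₂ ε : ℝ} (hθ₁ : 0 ≤ θ₁) (hθ₂ : 0 ≤ θ₂)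
    (hε0 : 0 ≤ ε) (hε : θ₁ * θ₂ * 2 ^ b ≤ ε ^ 2) {P Q : (Fin n → Fin b → Bool) → ℝ}
    (hP0 : ∀ x, 0 ≤ P x) (hP1 : ∑ x, P x = 1) (hPd : IsBlockwiseDense θ₁ P)
    (hQ0 : ∀ y, 0 ≤ Q y) (hQ1 : ∑ y, Q y = 1) (hQd : IsBlockwiseDense θ₂ Q) :
    ∃ h : (Fin n → Bool) → ℝ, IsDecaying ε h ∧ ∀ z, ipOutputDensity P Q z = 1 + h z :=
  ⟨fun z => ipOutputDensity P Q z - 1,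
    isDecaying_ipOutputDensity_sub_one hb hθ₁ hθ₂ hε0 hε hP0 hP1 hPd hQ0 hQ1 hQd, fun z => by ring⟩

/-! ### Lemma 5.3: aligned conjunctive-blockwise-dense sources give a conjunction times `(1 + h)` -/

/-- The number of points of the cube agreeing with `w` outside `I` is `2^{|I|}` (as a `0/1` sum).
[cite: KothariMekaRaghavendra2017, §5 (proof of Lemma 5.3: "Z_I = IP(α,β) and Z_{Ī} = IP(X_{Ī},Y_{Ī})")] -/
theorem sum_ite_agree_off (I : Finset (Fin n)) (w : Fin n → Bool) :
    ∑ z : Fin n → Bool, (if ∀ i ∈ Iᶜ, z i = w i then (1 : ℝ) else 0) = 2 ^ I.card := by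
  classical
  have h := sum_conjunction Iᶜ w
  have hc : ∀ z : Fin n → Bool,
      conjunction Iᶜ w z = 2 ^ Iᶜ.card * (if ∀ i ∈ Iᶜ, z i = w i then (1 : ℝ) else 0) := by
    intro z
    unfold conjunction
    split_ifs <;> simp
  simp_rw [hc] at h
  rw [← Finset.mul_sum] at h
  have hcard : Iᶜ.card + I.card = n := by
    rw [Finset.card_compl, Fintype.card_fin]
    have := I.card_le_univ
    rw [Fintype.card_fin] at this
    omega
  have h2 : (2 : ℝ) ^ n = 2 ^ Iᶜ.card * 2 ^ I.card := by rw [← pow_add, hcard]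
  rw [h2] at h
  exact mul_left_cancel₀ (pow_ne_zero _ two_ne_zero) h

/-- For `w` agreeing with `γ` on `I` and `T` disjoint from `I`:
`Σ_z [w = z|_{I←γ}] χ_T(z) = 2^{|I|} χ_T(w)` (the `2^{|I|}` points `z` with `z|_{I←γ} = w` are those
agreeing with `w` off `I`, and `χ_T` only reads coordinates off `I`).
[cite: KothariMekaRaghavendra2017, §5 (proof of Lemma 5.3)] -/
theorem sum_ite_eq_piecewise_mul_walsh (I T : Finset (Fin n)) (hTI : Disjoint T I)
    (γ w : Fin n → Bool) (hw : ∀ i ∈ I, w i = γ i) :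
    ∑ z : Fin n → Bool, (if w = I.piecewise γ z then walsh T z else 0) = 2 ^ I.card * walsh T w := by
  classical
  have hiff : ∀ z : Fin n → Bool, (w = I.piecewise γ z) ↔ (∀ i ∈ Iᶜ, z i = w i) := by
    intro z
    constructor
    · intro h i hi
      have := congrFun h i
      rw [Finset.piecewise_eq_of_notMem _ _ _ (Finset.mem_compl.1 hi)] at this
      exact this.symm
    · intro h
      funext i
      by_cases hi : i ∈ I
      · rw [Finset.piecewise_eq_of_mem _ _ _ hi, hw i hi]
      · rw [Finset.piecewise_eq_of_notMem _ _ _ hi, h i (Finset.mem_compl.2 hi)]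
  have hwal : ∀ z : Fin n → Bool, (∀ i ∈ Iᶜ, z i = w i) → walsh T z = walsh T w := by
    intro z hz
    exact Finset.prod_congr rfl fun i hi => by
      rw [hz i (Finset.mem_compl.2 (Finset.disjoint_left.1 hTI hi))]
  calc ∑ z : Fin n → Bool, (if w = I.piecewise γ z then walsh T z else 0)
      = ∑ z : Fin n → Bool, (if ∀ i ∈ Iᶜ, z i = w i then (1 : ℝ) else 0) * walsh T w := by
        refine sum_congr rfl fun z _ => ?_
        by_cases hz : ∀ i ∈ Iᶜ, z i = w i
        · rw [if_pos ((hiff z).2 hz), if_pos hz, hwal z hz, one_mul]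
        · rw [if_neg (fun h' => hz ((hiff z).1 h')), if_neg hz, zero_mul]
    _ = 2 ^ I.card * walsh T w := by rw [← Finset.sum_mul, sum_ite_agree_off]

/-- **KMR Lemma 5.3 — PROVED** (honest rate). Let `X ∼ P`, `Y ∼ Q` be independent on `({0,1}^b)ⁿ`,
ALIGNED conjunctive blockwise-dense: on the fixed blocks `I`, `X_I = α_I` and `Y_I = β_I` (i.e. `P`, `Q`
are supported there), and for every `S ⊆ [n] ∖ I` the `S`-block marginals have max-probability
`≤ θ₁^{|S|}`, `≤ θ₂^{|S|}`; let `θ₁ θ₂ 2^b ≤ ε²`. Then the output density of the gadget is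
`ν = C_{I, G(α,β)} · (1 + h)` for an `ε`-decaying `h`: "Let `X, Y` be aligned `d`-CBD random variables …
with the aligned blocks `I ⊆ [n]` and `X_I = α`, `Y_I = β`. Let `ν` be the density of `z = IP^{⊗n}(X,Y)`.
Then, for `ε = 2^{−0.5b}` [here: any `ε` with `ε² ≥ θ₁θ₂2^b`, e.g. `2^{−0.3b}` for the printed
`θ = 2^{−0.8b}`], there exists an `ε`-decaying function `h` such that
`ν = 𝟙[z_I = IP^{⊗|I|}(α,β)] · (1+h)`." Proof as printed (`Z_I` is fixed, `Z_{Ī}` falls under Lemma 5.1):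
`h(z) = 2^{−|I|} ν(z|_{I←G(α,β)}) − 1` depends only on `z_{Ī}`, and `ĥ(T) = ν̂(T) − [T = ∅]` for `T ∩ I = ∅`.
[cite: KothariMekaRaghavendra2017, Lemma 5.3 (§5)] -/
theorem exists_isDecaying_ipOutputDensity_eq_conjunction_mul (hb : 0 < b) {θ₁ θ₂ ε : ℝ}
    (hθ₁ : 0 ≤ θ₁) (hθ₂ : 0 ≤ θ₂) (hε0 : 0 ≤ ε) (hε : θ₁ * θ₂ * 2 ^ b ≤ ε ^ 2)
    {P Q : (Fin n → Fin b → Bool) → ℝ} (hP0 : ∀ x, 0 ≤ P x) (hP1 : ∑ x, P x = 1)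
    (hQ0 : ∀ y, 0 ≤ Q y) (hQ1 : ∑ y, Q y = 1) (I : Finset (Fin n)) (α β : Fin n → Fin b → Bool)
    (hPα : ∀ x, P x ≠ 0 → ∀ i ∈ I, x i = α i) (hQβ : ∀ y, Q y ≠ 0 → ∀ i ∈ I, y i = β i)
    (hPd : ∀ S : Finset (Fin n), Disjoint S I → ∀ ξ, blockMass P S ξ ≤ θ₁ ^ S.card)
    (hQd : ∀ S : Finset (Fin n), Disjoint S I → ∀ ζ, blockMass Q S ζ ≤ θ₂ ^ S.card) :
    ∃ h : (Fin n → Bool) → ℝ, IsDecaying ε h ∧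
      ∀ z, ipOutputDensity P Q z = conjunction I (ipMap b α β) z * (1 + h z) := by
  classical
  set γ : Fin n → Bool := ipMap b α β with hγ
  set ν : (Fin n → Bool) → ℝ := ipOutputDensity P Q with hν
  -- on the support, the `I`-coordinates of the output are those of `G(α,β)`
  have hsupp : ∀ x y, P x * Q y ≠ 0 → ∀ i ∈ I, ipMap b x y i = γ i := by
    intro x y hxy i hi
    have hx : x i = α i := hPα x (left_ne_zero_of_mul hxy) i hi
    have hy : y i = β i := hQβ y (right_ne_zero_of_mul hxy) i hi
    simp only [hγ, ipMap, hx, hy]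
  -- hence `ν` vanishes off `{z_I = γ_I}`
  have hν0 : ∀ z : Fin n → Bool, (¬ ∀ i ∈ I, z i = γ i) → ν z = 0 := by
    intro z hz
    rw [hν]
    unfold ipOutputDensity
    rw [mul_eq_zero]
    right
    refine sum_eq_zero fun x _ => sum_eq_zero fun y _ => ?_
    by_cases hPQ : P x * Q y = 0
    · split_ifs <;> simp [hPQ]
    · rw [if_neg]
      rintro rfl
      exact hz (hsupp x y hPQ)
  -- the correction `h`, a function of `z_{Ī}` only
  set g : (Fin n → Bool) → ℝ := fun w => ((2 : ℝ) ^ I.card)⁻¹ * ν w - 1 with hg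
  have h2I : (2 : ℝ) ^ I.card ≠ 0 := pow_ne_zero _ two_ne_zero
  have h2n : (2 : ℝ) ^ n ≠ 0 := pow_ne_zero _ two_ne_zero
  -- `E_T := E[χ_T(G(X,Y))]`
  -- the key counting identity: `Σ_z ν(z|_{I←γ}) χ_T(z) = 2^{|I|} Σ_z ν(z) χ_T(z)` for `T ∩ I = ∅`
  have hkey : ∀ T : Finset (Fin n), Disjoint T I →
      ∑ z : Fin n → Bool, ν (I.piecewise γ z) * walsh T z =
        (2 : ℝ) ^ I.card * ((2 : ℝ) ^ n * ∑ x, ∑ y, P x * Q y * walsh T (ipMap b x y)) := by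
    intro T hTI
    have hz : ∀ z : Fin n → Bool, ν (I.piecewise γ z) * walsh T z =
        (2 : ℝ) ^ n * ∑ x, ∑ y, P x * Q y *
          (if ipMap b x y = I.piecewise γ z then walsh T z else 0) := by
      intro z
      rw [hν]
      unfold ipOutputDensity
      rw [mul_assoc, Finset.sum_mul]
      congr 1
      refine sum_congr rfl fun x _ => ?_
      rw [Finset.sum_mul]
      refine sum_congr rfl fun y _ => ?_
      split_ifs <;> simp
    simp_rw [hz]
    rw [← Finset.mul_sum, Finset.sum_comm]
    rw [mul_left_comm]
    congr 1
    rw [Finset.mul_sum]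
    refine sum_congr rfl fun x _ => ?_
    rw [Finset.sum_comm, Finset.mul_sum]
    refine sum_congr rfl fun y _ => ?_
    rw [← Finset.mul_sum]
    by_cases hPQ : P x * Q y = 0
    · rw [hPQ, zero_mul, zero_mul, mul_zero]
    · rw [sum_ite_eq_piecewise_mul_walsh I T hTI γ (ipMap b x y) (hsupp x y hPQ)]
      ring
  -- coefficients of `h = g ∘ (·|_{I←γ})` off `I`
  have hcoef : ∀ T : Finset (Fin n), Disjoint T I →
      cubeFourierCoeff (fun z => g (I.piecewise γ z)) T =
        (∑ x, ∑ y, P x * Q y * walsh T (ipMap b x y)) - (if T = ∅ then 1 else 0) := by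
    intro T hTI
    unfold Literature.Computability.Complexity.LowDegree.cubeFourierCoeff
    have hsplit : ∑ z : Fin n → Bool, g (I.piecewise γ z) * walsh T z =
        ((2 : ℝ) ^ I.card)⁻¹ * ∑ z : Fin n → Bool, ν (I.piecewise γ z) * walsh T z -
          ∑ z : Fin n → Bool, (1 : ℝ) * walsh T z := by
      rw [Finset.mul_sum, ← Finset.sum_sub_distrib]
      refine sum_congr rfl fun z _ => ?_
      rw [hg]
      ring
    have h1 : ∑ z : Fin n → Bool, (1 : ℝ) * walsh T z = if T = ∅ then (2 : ℝ) ^ n else 0 := by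
      have := sum_walsh_mul_walsh_index (∅ : Finset (Fin n)) T
      simp only [walsh_empty] at this
      rw [this]
      by_cases hT : T = ∅
      · rw [if_pos hT, if_pos hT.symm]
      · rw [if_neg hT, if_neg (Ne.symm hT)]
    rw [hsplit, h1, hkey T hTI, ← mul_assoc, inv_mul_cancel₀ h2I, one_mul, sub_div,
      mul_div_cancel_left₀ _ h2n]
    congr 1
    split_ifs
    · exact div_self h2n
    · simp
  -- `E_∅ = 1`
  have hE0 : ∑ x, ∑ y, P x * Q y * walsh (∅ : Finset (Fin n)) (ipMap b x y) = 1 := by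
    simp only [walsh_empty, mul_one]
    have : ∀ x : Fin n → Fin b → Bool, ∑ y, P x * Q y = P x := fun x => by
      rw [← Finset.mul_sum, hQ1, mul_one]
    simp_rw [this]
    exact hP1
  refine ⟨fun z => g (I.piecewise γ z), ⟨?_, fun T => ?_⟩, fun z => ?_⟩
  · -- `E h = ĥ(∅) = E_∅ − 1 = 0`
    have h0 : cubeExpect (fun z => g (I.piecewise γ z)) =
        cubeFourierCoeff (fun z => g (I.piecewise γ z)) ∅ := by
      rw [cubeFourierCoeff_empty]; rfl
    rw [h0, hcoef ∅ (Finset.disjoint_empty_left I), if_pos rfl, hE0, sub_self]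
  · by_cases hTI : Disjoint T I
    · rw [hcoef T hTI]
      by_cases hT : T = ∅
      · subst hT
        rw [if_pos rfl, hE0, sub_self, abs_zero]
        positivity
      · rw [if_neg hT, sub_zero]
        exact abs_sum_walsh_ipMap_le_of_blockMass_le hb hθ₁ hθ₂ hε0 hε hP0 hP1 hQ0 hQ1 T
          (hPd T hTI) (hQd T hTI)
    · -- `h` does not read the coordinates in `I`
      obtain ⟨i, hiT, hiI⟩ : ∃ i ∈ T, i ∈ I := by
        by_contra hcon
        exact hTI (Finset.disjoint_left.2 fun i hiT hiI => hcon ⟨i, hiT, hiI⟩)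
      rw [cubeFourierCoeff_piecewise_eq_zero g I γ ⟨i, hiT, hiI⟩, abs_zero]
      positivity
  · -- the pointwise identity `ν = C · (1 + h)`
    by_cases hz : ∀ i ∈ I, z i = γ i
    · have hpw : I.piecewise γ z = z := by
        funext i
        by_cases hi : i ∈ I
        · rw [Finset.piecewise_eq_of_mem _ _ _ hi, hz i hi]
        · rw [Finset.piecewise_eq_of_notMem _ _ _ hi]
      have hC : conjunction I γ z = 2 ^ I.card := by
        unfold conjunction
        rw [if_pos hz]
      show ν z = conjunction I γ z * (1 + g (I.piecewise γ z))
      rw [hC, hpw, hg]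
      field_simp
      ring
    · have hC : conjunction I γ z = 0 := by
        unfold conjunction
        rw [if_neg hz]
      show ν z = conjunction I γ z * (1 + g (I.piecewise γ z))
      rw [hC, zero_mul, hν0 z hz]

/-- **Lemma 5.3, "in particular"**: for aligned conjunctive blockwise-dense sources with `|I| ≤ d` fixed
blocks, the output density `Acc_{u,v} = ν` is an `(ε, 0)`-approximate conical `d`-junta (Def. 2.2, the
tree's `IsApproxConicalJunta`). "In particular, if `u, v` are aligned `d`-CBD densities over `({−1,1}^b)ⁿ`,
then `Acc_{u,v}` is a `(2^{−.5b}, 0)`-approximate conical `d`-junta" (rate as repaired above).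
[cite: KothariMekaRaghavendra2017, Lemma 5.3 (§5)] -/
theorem isApproxConicalJunta_ipOutputDensity (hb : 0 < b) {θ₁ θ₂ ε : ℝ}
    (hθ₁ : 0 ≤ θ₁) (hθ₂ : 0 ≤ θ₂) (hε0 : 0 ≤ ε) (hε : θ₁ * θ₂ * 2 ^ b ≤ ε ^ 2)
    {P Q : (Fin n → Fin b → Bool) → ℝ} (hP0 : ∀ x, 0 ≤ P x) (hP1 : ∑ x, P x = 1)
    (hQ0 : ∀ y, 0 ≤ Q y) (hQ1 : ∑ y, Q y = 1) {d : ℕ} (I : Finset (Fin n)) (hI : I.card ≤ d)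
    (α β : Fin n → Fin b → Bool)
    (hPα : ∀ x, P x ≠ 0 → ∀ i ∈ I, x i = α i) (hQβ : ∀ y, Q y ≠ 0 → ∀ i ∈ I, y i = β i)
    (hPd : ∀ S : Finset (Fin n), Disjoint S I → ∀ ξ, blockMass P S ξ ≤ θ₁ ^ S.card)
    (hQd : ∀ S : Finset (Fin n), Disjoint S I → ∀ ζ, blockMass Q S ζ ≤ θ₂ ^ S.card) :
    IsApproxConicalJunta ε 0 d (ipOutputDensity P Q) := by
  obtain ⟨h, hh, hrep⟩ := exists_isDecaying_ipOutputDensity_eq_conjunction_mul hb hθ₁ hθ₂ hε0 hε hP0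
    hP1 hQ0 hQ1 I α β hPα hQβ hPd hQd
  refine ⟨1, fun _ => 1, fun _ => conjunction I (ipMap b α β), fun _ => h, fun _ => 0,
    fun _ => zero_le_one, by simp, fun _ => ⟨I, ipMap b α β, hI, rfl⟩, fun _ => hh,
    fun _ => le_rfl, ?_, fun z => ?_⟩
  · unfold cubeExpect
    simp
  · rw [hrep z]
    simp

/-! ### Theorem 5.5 (= Theorem 2.7) from a rectangular decomposition (Theorem 2.10) -/

/-- The output density of the gadget for a JOINT weight `J` on pairs (`2ⁿ · Σ_{G(x,y)=z} J(x,y)`); for a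
product weight this is `ipOutputDensity` (`jointOutputDensity_mul`). Used for the error term `γ_err` of
the decomposition, which need not be a product. [cite: KothariMekaRaghavendra2017, §5 (proof of Thm 5.5: "γ denotes the distribution of G(X,Y) for (X,Y) ∼ D_error")] -/
def jointOutputDensity (J : (Fin n → Fin b → Bool) → (Fin n → Fin b → Bool) → ℝ) : (Fin n → Bool) → ℝ :=
  fun z => (2 : ℝ) ^ n * ∑ x, ∑ y, if ipMap b x y = z then J x y else 0

/-- For product weights the joint output density is `ipOutputDensity`. [cite: KothariMekaRaghavendra2017, §5 (proof of Thm 5.5)] -/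
theorem jointOutputDensity_mul (P Q : (Fin n → Fin b → Bool) → ℝ) :
    jointOutputDensity (fun x y => P x * Q y) = ipOutputDensity P Q := rfl

/-- `E_z[jointOutputDensity J] = Σ_{x,y} J(x,y)` (total mass is preserved by the push-forward).
[cite: KothariMekaRaghavendra2017, §2.2 ("Acc_{u,v} is a density")] -/
theorem cubeExpect_jointOutputDensity (J : (Fin n → Fin b → Bool) → (Fin n → Fin b → Bool) → ℝ) :
    cubeExpect (jointOutputDensity J) = ∑ x, ∑ y, J x y := by
  classical
  unfold cubeExpect jointOutputDensity
  have h2 : (2 : ℝ) ^ n ≠ 0 := pow_ne_zero _ two_ne_zero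
  rw [← Finset.mul_sum, mul_div_cancel_left₀ _ h2, Finset.sum_comm]
  refine sum_congr rfl fun x _ => ?_
  rw [Finset.sum_comm]
  refine sum_congr rfl fun y _ => ?_
  rw [Finset.sum_ite_eq]
  simp

/-- The joint output density is non-negative for non-negative weights. [cite: KothariMekaRaghavendra2017, Def. 2.5] -/
theorem jointOutputDensity_nonneg {J : (Fin n → Fin b → Bool) → (Fin n → Fin b → Bool) → ℝ}
    (hJ : ∀ x y, 0 ≤ J x y) (z : Fin n → Bool) : 0 ≤ jointOutputDensity J z := by
  unfold jointOutputDensity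
  refine mul_nonneg (by positivity) (sum_nonneg fun x _ => sum_nonneg fun y _ => ?_)
  split_ifs
  · exact hJ x y
  · exact le_rfl

/-- Linearity of the push-forward in the joint weight, in the shape of a decomposition
`J = Σ_i λ_i (P_i ⊗ Q_i) + λ_err E`. [cite: KothariMekaRaghavendra2017, §5 (proof of Thm 5.5: "Acc_{u,v} = Σ λ_i Acc_{u_i,v_i} + λ_err γ")] -/
theorem jointOutputDensity_decomposition {N : ℕ} (lam : Fin N → ℝ)
    (Pc Qc : Fin N → (Fin n → Fin b → Bool) → ℝ) (lamErr : ℝ)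
    (E : (Fin n → Fin b → Bool) → (Fin n → Fin b → Bool) → ℝ) (z : Fin n → Bool) :
    jointOutputDensity (fun x y => ∑ i, lam i * (Pc i x * Qc i y) + lamErr * E x y) z =
      ∑ i, lam i * ipOutputDensity (Pc i) (Qc i) z + lamErr * jointOutputDensity E z := by
  classical
  unfold jointOutputDensity ipOutputDensity
  have hite : ∀ x y : Fin n → Fin b → Bool,
      (if ipMap b x y = z then ∑ i, lam i * (Pc i x * Qc i y) + lamErr * E x y else 0) =
        ∑ i, lam i * (if ipMap b x y = z then Pc i x * Qc i y else 0) +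
          lamErr * (if ipMap b x y = z then E x y else 0) := by
    intro x y
    split_ifs
    · rfl
    · simp
  simp_rw [hite, Finset.sum_add_distrib]
  rw [mul_add]
  congr 1
  · -- the pieces
    have hx : ∀ x : Fin n → Fin b → Bool,
        ∑ y, ∑ i, lam i * (if ipMap b x y = z then Pc i x * Qc i y else 0) =
          ∑ i, lam i * ∑ y, (if ipMap b x y = z then Pc i x * Qc i y else 0) := by
      intro x
      rw [Finset.sum_comm]
      exact sum_congr rfl fun i _ => by rw [Finset.mul_sum]
    simp_rw [hx]
    rw [Finset.sum_comm, Finset.mul_sum]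
    refine sum_congr rfl fun i _ => ?_
    rw [← Finset.mul_sum]
    ring
  · -- the error
    have hx : ∀ x : Fin n → Fin b → Bool,
        ∑ y, lamErr * (if ipMap b x y = z then E x y else 0) =
          lamErr * ∑ y, (if ipMap b x y = z then E x y else 0) := fun x => by rw [Finset.mul_sum]
    simp_rw [hx]
    rw [← Finset.mul_sum]
    ring

/-- **A rectangular decomposition of `P ⊗ Q` into aligned conjunctive-blockwise-dense pieces** — the
CONCLUSION of KMR Theorem 2.10 / 2.11 (Thm 6.4) for the pair `(P,Q)`, as data:
`P ⊗ Q = Σ_i λ_i (P_i ⊗ Q_i) + λ_err E` with probability vectors `P_i, Q_i` that are aligned `d`-CBD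
(fixed blocks `I_i`, `|I_i| ≤ d`, `P_i` supported on `{x_{I_i} = α_i}`, `Q_i` on `{y_{I_i} = β_i}`, block
marginals off `I_i` bounded by `θ₁^{|S|}`, `θ₂^{|S|}`), weights `λ_i, λ_err ≥ 0` summing to `1`,
`λ_err ≤ δ`, and a joint probability `E` for the error. (A predicate on `(P,Q)` with parameters — Theorem
2.10 itself, "every pair with `H_∞(u)+H_∞(v) ≥ 2(n−t) log q` has such a decomposition with
`λ_err < q^{−Ω(d)}` for `d ≥ ct/log q`", is NOT asserted here.)
[cite: KothariMekaRaghavendra2017, Thm 2.10 / 2.11 (§2.3) and Thm 6.4 (§6.2)] -/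
def HasAlignedDecomposition (θ₁ θ₂ : ℝ) (d : ℕ) (δ : ℝ) (P Q : (Fin n → Fin b → Bool) → ℝ) : Prop :=
  ∃ (N : ℕ) (lam : Fin N → ℝ) (Pc Qc : Fin N → (Fin n → Fin b → Bool) → ℝ) (I : Fin N → Finset (Fin n))
    (α β : Fin N → (Fin n → Fin b → Bool)) (lamErr : ℝ)
    (E : (Fin n → Fin b → Bool) → (Fin n → Fin b → Bool) → ℝ),
    (∀ i, 0 ≤ lam i) ∧ 0 ≤ lamErr ∧ ∑ i, lam i + lamErr = 1 ∧ lamErr ≤ δ ∧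
    (∀ i x, 0 ≤ Pc i x) ∧ (∀ i, ∑ x, Pc i x = 1) ∧ (∀ i y, 0 ≤ Qc i y) ∧ (∀ i, ∑ y, Qc i y = 1) ∧
    (∀ i, (I i).card ≤ d) ∧
    (∀ i x, Pc i x ≠ 0 → ∀ j ∈ I i, x j = α i j) ∧ (∀ i y, Qc i y ≠ 0 → ∀ j ∈ I i, y j = β i j) ∧
    (∀ i (S : Finset (Fin n)), Disjoint S (I i) → ∀ ξ, blockMass (Pc i) S ξ ≤ θ₁ ^ S.card) ∧
    (∀ i (S : Finset (Fin n)), Disjoint S (I i) → ∀ ζ, blockMass (Qc i) S ζ ≤ θ₂ ^ S.card) ∧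
    (∀ x y, 0 ≤ E x y) ∧ ∑ x, ∑ y, E x y = 1 ∧
    ∀ x y, P x * Q y = ∑ i, lam i * (Pc i x * Qc i y) + lamErr * E x y

/-- **KMR Theorem 5.5 (= Thm 2.7, junta approximation), from the decomposition — PROVED.** If `P ⊗ Q`
has a rectangular decomposition into aligned conjunctive-blockwise-dense pieces with error weight
`λ_err ≤ δ` (`HasAlignedDecomposition θ₁ θ₂ d δ P Q`, the conclusion of Thm 2.10) and `θ₁ θ₂ 2^b ≤ ε²`,
then the output density `Acc_{u,v} = ν` of the gadget is an `(ε, δ)`-approximate conical `d`-junta.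
Printed: "Acc_{u,v} = Σ_i λ_i Acc_{u_i,v_i} + λ_err γ(z) … by Lemma 5.3 each `Acc_{u_i,v_i}` is a
`(2^{−.5b},0)`-approximate conical `d`-junta. Hence `Acc_{u,v}` is a `(2^{−.5b}, λ_err)`-approximate conical
`d`-junta." (Rate repaired as in Lemma 5.1; the existence of the decomposition, Thm 2.10/6.4, is the
hypothesis.) [cite: KothariMekaRaghavendra2017, Thm 5.5 / Thm 2.7 with its proof from Thm 2.10 (§5)] -/
theorem isApproxConicalJunta_ipOutputDensity_of_hasAlignedDecomposition (hb : 0 < b) {θ₁ θ₂ ε : ℝ}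
    (hθ₁ : 0 ≤ θ₁) (hθ₂ : 0 ≤ θ₂) (hε0 : 0 ≤ ε) (hε : θ₁ * θ₂ * 2 ^ b ≤ ε ^ 2) {d : ℕ} {δ : ℝ}
    {P Q : (Fin n → Fin b → Bool) → ℝ} (hdec : HasAlignedDecomposition θ₁ θ₂ d δ P Q) :
    IsApproxConicalJunta ε δ d (ipOutputDensity P Q) := by
  classical
  obtain ⟨N, lam, Pc, Qc, I, α, β, lamErr, E, hlam0, hErr0, hsum1, hErrδ, hPc0, hPc1, hQc0, hQc1, hI,
    hPcα, hQcβ, hPcd, hQcd, hE0, hE1, hPQ⟩ := hdec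
  -- Lemma 5.3 on each piece
  have hpiece : ∀ i, ∃ h : (Fin n → Bool) → ℝ, IsDecaying ε h ∧
      ∀ z, ipOutputDensity (Pc i) (Qc i) z = conjunction (I i) (ipMap b (α i) (β i)) z * (1 + h z) :=
    fun i => exists_isDecaying_ipOutputDensity_eq_conjunction_mul hb hθ₁ hθ₂ hε0 hε (hPc0 i) (hPc1 i)
      (hQc0 i) (hQc1 i) (I i) (α i) (β i) (hPcα i) (hQcβ i) (hPcd i) (hQcd i)
  choose h hh hrep using hpiece
  -- the decomposition of the output density
  have hout : ∀ z, ipOutputDensity P Q z =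
      ∑ i, lam i * ipOutputDensity (Pc i) (Qc i) z + lamErr * jointOutputDensity E z := by
    intro z
    have h1 : ipOutputDensity P Q =
        jointOutputDensity (fun x y => ∑ i, lam i * (Pc i x * Qc i y) + lamErr * E x y) := by
      rw [← jointOutputDensity_mul]
      congr 1
      funext x y
      exact hPQ x y
    rw [h1, jointOutputDensity_decomposition]
  refine ⟨N, lam, fun i => conjunction (I i) (ipMap b (α i) (β i)), h,
    fun z => lamErr * jointOutputDensity E z, hlam0, by linarith, fun i => ⟨I i, _, hI i, rfl⟩, hh,
    fun z => mul_nonneg hErr0 (jointOutputDensity_nonneg hE0 z), ?_, fun z => ?_⟩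
  · -- `E γ = λ_err · Σ E = λ_err ≤ δ`
    have : cubeExpect (fun z => lamErr * jointOutputDensity E z) = lamErr * cubeExpect (jointOutputDensity E) :=
      cubeExpect_const_mul lamErr _
    rw [this, cubeExpect_jointOutputDensity, hE1, mul_one]
    exact hErrδ
  · rw [hout z]
    congr 1
    exact sum_congr rfl fun i _ => by rw [hrep i z]

end Literature.Combinatorics.Optimization

end
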